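import Literature.MathematicalPhysics.QuantumFieldTheory.Balaban1983to89.B9Eq3114Proof
import Literature.MathematicalPhysics.QuantumFieldTheory.Balaban1983to89.B9Eq326OperatorTower
import Literature.MathematicalPhysics.QuantumFieldTheory.Balaban1983to89.B9Eq319ContourAxialGauge
import Literature.MathematicalPhysics.QuantumFieldTheory.Balaban1983to89.B5Eq155FlatAveragingCommute
import Literature.MathematicalPhysics.QuantumFieldTheory.Balaban1983to89.B9Eq332QprimeTowerGaugeCovariance

/-!
# `Balaban1983to89.B9Eq3115QkGaugeModeTower` — T. Bałaban, *Propagators for lattice gauge theories in a background field*, Commun. Math. Phys. **99**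
# (1985) 389–434 [Balaban1985BackgroundPropagators] (3.114)–(3.115) p. 418 *«(QD^{L⁻¹}λ)(c) = R̄_c(Q′λ)(c₊) − (Q′λ)(c₋) = (D_ŪQ′λ)(c) … Iterating this
# identity we obtain finally Q_jDλ = D̄ʲQ′_jλ … In particular they imply that the average QA are invariant with respect to gauge transformations λ
# satisfying Q′λ = 0, i.e. λ ∈ N(Q′)»*, with (3.15)∕(3.19) p. 393, (3.3) p. 391 and [Balaban1985Averaging] (42)–(43) pp. 23–24, (124) p. 36:
# **(3.114)∕(3.115) AT THE pub-balaban NE9 CHAIN's `k`-TH-STEP LETTERS — `Q_{n+1}(U)(D_Uλ) = η⁻¹L^{−(n+1)}·D_{Ū^{n+1}}(Q′_{n+1}(U)λ)` for the composite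
# averagings `B9Eq326OperatorTower.QkW` ∕ `QprimeTowerW` on the weighted `L²` carriers, hence `Q′_{n+1}(U)λ = 0 ⟹ Q_{n+1}(U)(D_Uλ) = 0`** — the displayed
# letter (g2) of the NE9 owner's `Δ_π` port (`B9Eq3119DeltaPiTower`, gen 87) DISCHARGED from lit-balaban's `ℤᵈ` identity `B9Eq3114Proof.eq3114`

statement-level skeleton of published theorems with citation tags; proofs where landed; nothing here is a claim about the Yang–Mills mass gap

PDF held: `paper:balaban1985-cmp99-background-propagators` (journal page = PDF page + 388), p. 418 (3.113)–(3.115), p. 393 (3.15)∕(3.19), p. 391 (3.3) —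
read by this seat through the verbatim quotations of `B9Eq3114Proof` (lit-balaban p15, which read pp. 417–418 as images), `B9Eq315QTorus`, `B9Eq315QTower`,
`B9Eq319QprimeTorus`; [Balaban1985Averaging] `paper:balaban1985-cmp98-averaging` (42)–(43) pp. 23–24, (124) p. 36, p. 24 (the axial gauge `v₀(x) = V(Γ_{y,x})`)
through `B7Prop1Explicit`, `B7Prop2Explicit`, `B7Eq44TorusAxialGaugeLocal`.

CITATION HEADER (lean-in-tree rule).  Audit cell `pub-balaban`, sub-cell `t4`, BINDER row NE9; filed by the NE9 crux-team (2) LEAF PROVER 02 lineage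
`b2b-balaban-t4-ne9-formalise-leaf-02` (gen 67) on the row OWNER t4-ne9-p1 g87's OFFER (journal `[NE9P1-G87-STAGED4]`: «the bridge to `QkW`∕`QprimeTowerW`
… is a separate file, offered: FIRST REFUSAL ne9-leaf-04 ∕ ne9-leaf-02 (`Q_k` letters)»; taken `[NE9LEAF02-G67-X67]` W-5).

WHY THIS FILE (cell context).  The OWNER's DIAGNOSIS D-ne9p1-g87-1 ports the `k`-level chain from the bare-Hessian operator `G₀⁻¹ = Δ + DRD* + Q*aQ` to
print's `G̃⁻¹ = Δ_π + DRD* + Q*aQ` (3.122); his `B9Eq3119DeltaPiTower` proves print's (3.124)-identities `Q_kG̃D_UR_k = 0`, `R_kD*_UG̃D_UR_k = R_k`,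
`R_kD*_UG̃Q_k† = 0` and [Balaban1985Variational] p. 294 `Q𝔊 = 0`, `RD*𝔊 = 0` for the `k`-th-step letters MODULO ONE displayed letter
(g2) = (3.115): `∀ l, QprimeTowerW L m n φ U l = 0 → QkW L m n φ U hL αU hα1 hU1 hreg (covDerivL2K ℂ c₀ η⁻¹ (adTransportW φ U) l) = 0`.  The lit-balaban
cell proved (3.114)∕(3.115) as exact identities on the `ℤᵈ` carrier (`B9Eq3114Proof.eq3114`, `eq3115`, `linCovIter_gauge_of_null`); the chain's objects
live on the torus tower `T_{L^{n+1}m} → ⋯ → T_m` with `W`-valued weighted `L²` carriers.  THIS FILE is the bridge: (g2) becomes a theorem of the chain's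
letters, with NO hypothesis beyond E162's per-level regularity witnesses that `QkW` already carries.

WHAT IS PROVED (sorry-free; proof lane — no `def`, no `Prop` placeholder; nothing of the papers asserted hypothesis-free; [folklore] bookkeeping over
landed identities).
* §1 lattice bookkeeping: `cornerSite_eq_liftSite_centre` (`L·y` is the representative of the block centre), `liftSite_blockSite_sub_centre` (the site
  `L·y + r` of `B(y)` minus the centre lifts to the offset `r`), `cornerSite_add_smul_e` (`L·y + L·e_κ` and `L·(y + e_κ)` differ by a FINE period).
* §2 readings in the algebra along the fibre identification `φ : W ≃ 𝔸`: `toAlg_covDeriv_one` ∕ `toAlg_covDeriv_smul` ((3.3): `φ((D_Vl)(b)) =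
  R(V(b))φ(l(b₊)) − φ(l(b₋))`, the scalar factors out), `perCfg_toAlg_covDeriv_one` (its periodic extension IS the `ℤᵈ` forward covariant difference
  `B8Ineq132.covDerivFwd` of the periodic extension of `φ ∘ l`), **`toAlg_QprimeLin`** — (3.19) read on `ℤᵈ`: `φ((Q′(V)l)(y)) = Σ_{r∈[0,L)ᵈ} L^{−d}·
  R(Ṽ(Γ_{Ly,Ly+r}))φ(l(Ly+r))`: the torus contour transport of `B9Eq319QprimeTorus.QprimeLin` IS the tree holonomy `hol ∘ treeWord` of the periodic extension
  (ne9-leaf-03∕05's `B9Eq319ContourAxialGauge.pathTr_contour_adTransportW_eq_AdW` + `B7Eq44TorusAxialGaugeLocal.axialGaugeTAt` = `B7Prop1Explicit.axialFn`,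
  the block bijection `B5Eq155FlatAveragingCommute.sum_blockOf_eq_sum_boxVec` of ne9-leaf-01).
* §2 **`QtorusLin_toAlg_covDeriv`** = **(3.114) ON THE TORUS**: `Q(V)(φ ∘ D_V l)(y, κ) = L⁻¹·(R(V̄_{(y,κ)})φ((Q′(V)l)(y + e_κ)) − φ((Q′(V)l)(y)))`, `V̄ = bavg L Ṽ`
  the block average (42), for the one-step `B9Eq315QTorus.QtorusLin` at ANY background of E162's data — lit-balaban's `eq3114` (loop condition = E162's
  `hreg`, `α ≤ 1∕64 < 1`) read through `QtorusLin_apply`, `perCfg_toAlg_covDeriv_one`, `toAlg_QprimeLin`; the wrap of `y_κ` is a fine period, invisible to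
  `hol ∘ perCfg` (`B9Eq315QTorusOnto.hol_perCfg_add_periodVec`) and to `perSite` (`perSite_cornerSite_add_boxVec_add`).
* §3 **`Qtower_toAlg_covDeriv`** = **(3.115) FOR A TOWER** of level data `Ulev` (`B9Eq315QTower.Qtower` ∕ `QprimeTower`) and a family `Wlev` of bond
  backgrounds with the two DISPLAYED compatibilities `Wlev (j+1) = Ulev j`, `Wlev j = bavg(Ulev j)` (levels `< k`): the depth-`j` composite of `φ ∘ D_{Wlev j} l`
  is `L^{−j}·` the `Wlev 0`-covariant derivative of `Q′_j l`, by induction on `j` from §2.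
* §4 at the chain's letters (ONE background `U` on `T_{L^{n+1}m}`, `Ū^j` = `UlevOf`, the compatibilities DISCHARGED by `avgIter_succ` ∕ `perCfg_UlevOf`):
  **`equiv_QkW_covDerivL2K`** — `(Q_{n+1}(U)(D^{η⁻¹}_U l))(y, κ) = η⁻¹L^{−(n+1)}·(R(Ū^{n+1}(y,κ))(Q′_{n+1}(U)l)(y + e_κ) − (Q′_{n+1}(U)l)(y))` for
  `B9Eq326OperatorTower.QkW` ∕ `QprimeTowerW` and `B11Eq103H1Complex.covDerivL2K` (the averaged background `Ū^{n+1}` read at the representatives,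
  `avgIter L Ũ (n+1) (liftSite ·)`; on print's diagonal `ηL^{n+1} = 1` the prefactor is `1` = print's `D̄ᵏ` of unit spacing); and the letter
  **`QkW_covDerivL2K_eq_zero_of_QprimeTowerW_eq_zero`** = (g2) VERBATIM: `QprimeTowerW L m n φ U l = 0 → QkW L m n φ U hL αU hα1 hU1 hreg (covDerivL2K ℂ c₀
  ((η : ℂ))⁻¹ (adTransportW φ U) l) = 0`, with the corollary `QkW_sub_covDerivL2K_of_QprimeTowerW_eq_zero` (print's *«the average QA are invariant with
  respect to gauge transformations λ … ∈ N(Q′)»*: `Q_{n+1}(U)(A − D_Uλ) = Q_{n+1}(U)A`).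
MODEL ∕ DECLARED READINGS.  (M1) those of `B9Eq315QTower` ∕ `B9Eq326OperatorTower`: the tower `towerP L m`, periodic readings on `ℤᵈ`, fibre `W` read along
`φ`, weights `c₀`, `c₁` (free), scalar `η⁻¹` (any real `η`; at `η = 0` both sides of §4 vanish); `𝔸` a complete normed `ℂ`-algebra with `‖1‖ = 1`.  (M2) the
per-level regularity witnesses `(αU, hα1, hU1, hreg)` of `QkW` are the ONLY hypotheses — (3.114) needs the block loops in the disc of the logarithm, which
`hreg` (`α_j ≤ 1∕64`) gives; no smallness of `U` itself, no unitarity, no window.  (M3) `Q(V)` = the LINEAR one-step operator of (3.14)–(3.15) (`linQcov`, READING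
C-adv4-22, normalised by `L⁻¹`), `Q′(V)` = (3.19) with the tree contour of [B5] (1.7) (direction order `d−1, …, 0` on both carriers — the identification is
`pathTr_contour_adTransportW_eq_AdW`, not re-proved).
HONEST SCOPE.  [folklore] bookkeeping (periodic readings, block bijections, a fine-period wrap, an induction on levels, scalars) over the lit-balaban cell's
kernel-checked identity (3.114) and the chain's landed dictionaries; no estimate; nothing of [B9] asserted beyond what `B9Eq3114Proof` PROVES.  NOT summit
progress (cell pub-balaban: NE9 NOT PRINTED ∕ NOT PROVED; «NE9 ⇐ the named binders»; row WALLED ON A MODEL (O-NE9-1; NEEDS-COORDINATOR #5 UNRULED); spine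
PROVED 0∕9; rung (B)+1 finite T⁴ — NOT infinite volume, NOT mass gap, NOT BetaPertH, NOT Clay).  HONEST DEPENDENCY (cell line): continuum YM on T⁴ ⇐
BetaPertH ∧ nine spine estimates (0/9 proved); BetaPertH ⇐ (D1) ∧ (D4) ∧ CAP+tail; G-an2-4 gates asym, D1 and NE2/3/4.  NEW file; nothing modified.  Net new
unproved facts: 0.
-/

noncomputable section

open scoped BigOperators InnerProductSpace ComplexConjugate

namespace Literature.MathematicalPhysics.QuantumFieldTheory.Balaban1983to89.B9Eq3115QkGaugeModeTower

open B4Sect5Torus (TSite)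
open B9SectCLatticeCarrier (Bond shift bpos btgt)
open B7Prop1Explicit (e boxVec U1 Wcx hol treeWord axialFn bavg)
open B7Prop2Explicit (avgIter avgIter_succ avgIter_zero rescale)
open B7Eq78Linearization (conjR conjR_apply conjR_sub)
open B8Ineq132 (covDerivFwd)
open B7Prop3GeneralLinear (linQcov)
open B7Eq125RightInverse (corner corner_apply)
open B9Eq33CovDerivVector (covDeriv covDeriv_apply)
open B9Eq311L2Pairing (WL2)
open B11Eq103H1Complex (SiteL2K BondL2K covDerivL2K equiv_covDerivL2K)
open B9Eq310HessianOperator (adTransportW adTransportW_apply)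
open B9Eq328GaugeAction (AdW AdW_apply)
open B9Eq323Ker (avgQ pathTr)
open B9Eq319QprimeTorus (fineP centre blockOf QprimeLin QprimeLin_apply Qprime_eq_avgQ weight)
open B9Eq315QTorus (perSite perCfg perCfg_apply cornerSite QtorusLin QtorusLin_apply)
open B9Eq315QTorusOnto (liftSite periodVec perSite_add_periodVec perSite_liftSite liftSite_perSite_add cornerSite_eq hol_perCfg_add_periodVec)
open B9Eq315QTower (towerP UlevOf Qtower Qtower_zero Qtower_succ QkOfU QprimeTower QprimeTower_zero QprimeTower_succ perCfg_UlevOf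
  corner_eq_smul corner_periodVec)
open B9Eq326OperatorTower (QprimeTowerW QkW)
open B7Eq44TorusAxialGaugeLocal (axialGaugeTAt axialGaugeTAt_apply)
open B9Eq319ContourAxialGauge (pathTr_contour_adTransportW_eq_AdW)
open B5Eq155FlatAveragingCommute (shift_perSite sum_blockOf_eq_sum_boxVec perSite_cornerSite_add_boxVec_add
  perSite_cornerSite_add_boxVec_apply_val liftSite_shift_add_periodVec)
open B9Eq332QprimeTowerGaugeCovariance (liftSite_centre)
open B9Eq3114Proof (eq3114)

variable {d : ℕ}

/-! ## §1 Lattice bookkeeping -/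

section Lattice

variable (L : ℕ) (P : Fin d → ℕ)

/-- The corner `L·y` of the block of `y` is the representative of its centre. [cite: Balaban1985Averaging, (2) p.17] -/
theorem cornerSite_eq_liftSite_centre [NeZero L] (y : TSite d P) : cornerSite L y = liftSite (centre L P y) := by
  rw [liftSite_centre, cornerSite_eq, corner_eq_smul]

/-- The site `L·y + r` of the block `B(y)` minus the centre, lifted to `ℤ^d`, is the offset `r`. [cite: Balaban1985Averaging, (2) p.17] -/
theorem liftSite_blockSite_sub_centre [NeZero L] [∀ i, NeZero (fineP L P i)] (y : TSite d P) (r : Fin d → Fin L) :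
    liftSite (perSite (fineP L P) (cornerSite L y + boxVec L r) - centre L P y) = boxVec L r := by
  funext i
  have hx := perSite_cornerSite_add_boxVec_apply_val L P y r i
  have hc : ((centre L P y i : ℕ)) = L * (y i : ℕ) := B9Eq319QprimeTorus.centre_apply_val L P y i
  have hle : centre L P y i ≤ perSite (fineP L P) (cornerSite L y + boxVec L r) i := by
    rw [Fin.le_def, hc, hx]; omega
  simp only [liftSite, Pi.sub_apply, Fin.sub_val_of_le hle, hx, hc, boxVec]
  omega

/-- `L·y + L·e_κ` and the corner of the block of `y + e_κ` differ by a fine period. [cite: Balaban1985Averaging, (2) p.17] -/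
theorem cornerSite_add_smul_e (y : TSite d P) (κ : Fin d) :
    ∃ t : B7Prop1Explicit.Site d, cornerSite L y + (L : ℤ) • e κ = cornerSite L (shift κ y) + periodVec (fineP L P) t := by
  refine ⟨Pi.single κ ((((y κ : ℕ) + 1) / P κ : ℕ) : ℤ), ?_⟩
  rw [cornerSite_eq, cornerSite_eq, corner_eq_smul, corner_eq_smul, ← corner_periodVec, corner_eq_smul, ← smul_add, ← smul_add,
    liftSite_shift_add_periodVec]

end Lattice

/-! ## §2 The derivative letter and the block average read in the algebra -/

section OneStep

variable {𝔸 : Type*} [NormedRing 𝔸] [NormedAlgebra ℂ 𝔸] [CompleteSpace 𝔸] [NormOneClass 𝔸]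
  {W : Type*} [NormedAddCommGroup W] [InnerProductSpace ℂ W] (φ : W ≃ₗ[ℂ] 𝔸)

omit [CompleteSpace 𝔸] [NormOneClass 𝔸] in
/-- **(3.3) read in the algebra**: `φ((D_V l)(b)) = R(V(b))φ(l(b₊)) − φ(l(b₋))` (unit scalar). [cite: Balaban1985BackgroundPropagators, (3.3) p.391] -/
theorem toAlg_covDeriv_one {P : Fin d → ℕ} (V : Bond d P → 𝔸ˣ) (l : TSite d P → W) (b : Bond d P) :
    φ (covDeriv (1 : ℂ) (adTransportW φ V) l b) = conjR (V b) (φ (l (btgt b))) - φ (l (bpos b)) := by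
  rw [covDeriv_apply, one_smul, map_sub, adTransportW_apply, LinearEquiv.apply_symm_apply, conjR_apply]

omit [CompleteSpace 𝔸] [NormOneClass 𝔸] in
/-- The scalar of (3.3) factors out: `φ ∘ D^{c}_V l = c • (φ ∘ D^{1}_V l)`. [cite: Balaban1985BackgroundPropagators, (3.3) p.391] -/
theorem toAlg_covDeriv_smul {P : Fin d → ℕ} (c : ℂ) (V : Bond d P → 𝔸ˣ) (l : TSite d P → W) :
    (fun b => φ (covDeriv c (adTransportW φ V) l b)) = c • fun b => φ (covDeriv (1 : ℂ) (adTransportW φ V) l b) := by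
  funext b
  rw [Pi.smul_apply, covDeriv_apply, covDeriv_apply, one_smul, map_smul]

omit [CompleteSpace 𝔸] [NormOneClass 𝔸] in
/-- **The periodic extension of `φ ∘ D_V l` is the `ℤ^d` forward covariant difference** `D¹_{Ṽ}` of the periodic extension of `φ ∘ l`
(`B8Ineq132.covDerivFwd` at `η = 1`). [cite: Balaban1985BackgroundPropagators, (3.3) p.391; Balaban1985Averaging, (1) p.17] -/
theorem perCfg_toAlg_covDeriv_one {P : Fin d → ℕ} [∀ i, NeZero (P i)] (V : Bond d P → 𝔸ˣ) (l : TSite d P → W) :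
    perCfg P (fun b => φ (covDeriv (1 : ℂ) (adTransportW φ V) l b)) =
      fun z μ => covDerivFwd 1 (perCfg P V) μ (fun z => φ (l (perSite P z))) z := by
  funext z μ
  rw [perCfg_apply, toAlg_covDeriv_one]
  simp only [covDerivFwd, inv_one, one_smul, perCfg_apply, btgt, bpos, shift_perSite]

variable (L : ℕ) [NeZero L] (P : Fin d → ℕ) [∀ i, NeZero (fineP L P i)]

omit [CompleteSpace 𝔸] [NormOneClass 𝔸] in
/-- **(3.19) read in the algebra on `ℤ^d`**: `φ((Q′(V)l)(y)) = Σ_{r∈[0,L)^d} L^{−d}·R(Ṽ(Γ_{Ly,Ly+r}))φ(l(Ly+r))` — the torus contour transport of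
`B9Eq319QprimeTorus.QprimeLin` IS the tree holonomy of the periodic extension (`B9Eq319ContourAxialGauge.pathTr_contour_adTransportW_eq_AdW`, the rooted
axial gauge `B7Eq44TorusAxialGaugeLocal.axialGaugeTAt` = `B7Prop1Explicit.axialFn`), the block sum the sum over the offsets.
[cite: Balaban1985BackgroundPropagators, (3.19) p.393; Balaban1985Averaging, (9) p.18, p.24] -/
theorem toAlg_QprimeLin (V : Bond d (fineP L P) → 𝔸ˣ) (l : TSite d (fineP L P) → W) (y : TSite d P) :
    φ (QprimeLin L P (adTransportW φ V) l y) =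
      ∑ r : Fin d → Fin L, (((L : ℝ) ^ d)⁻¹) •
        conjR (hol (perCfg (fineP L P) V) (cornerSite L y) (treeWord (boxVec L r))) (φ (l (perSite (fineP L P) (cornerSite L y + boxVec L r)))) := by
  rw [QprimeLin_apply, Qprime_eq_avgQ]
  simp only [avgQ]
  rw [sum_blockOf_eq_sum_boxVec, map_sum]
  refine Finset.sum_congr rfl fun r _ => ?_
  have hx := B5Eq155FlatAveragingCommute.perSite_cornerSite_add_boxVec_mem L P y r
  rw [pathTr_contour_adTransportW_eq_AdW L P V φ hx, weight, ← Complex.coe_smul, map_smul, Complex.coe_smul, AdW_apply,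
    LinearEquiv.apply_symm_apply, ← conjR_apply, axialGaugeTAt_apply, axialFn, add_sub_cancel_left, liftSite_blockSite_sub_centre,
    ← cornerSite_eq_liftSite_centre]

variable (hL : 1 ≤ L) (V : Bond d (fineP L P) → 𝔸ˣ) {α : ℝ} (hα1 : α ≤ 1 / 64)
  (hV1 : ∀ (x : B7Prop1Explicit.Site d) (κ : Fin d), perCfg (fineP L P) V x κ ∈ U1 𝔸)
  (hreg : ∀ (y : TSite d P) (κ : Fin d) (r : Fin d → Fin L),
    ‖((Wcx L (perCfg (fineP L P) V) (cornerSite L y) κ (boxVec L r) : 𝔸ˣ) : 𝔸) - 1‖ ≤ α)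

/-- **(3.114) ON THE TORUS, AT THE CHAIN's LETTERS: `Q(V)(D_V l) = D_{V̄}(Q′(V) l)`** — the one-step vector averaging `B9Eq315QTorus.QtorusLin` of
(3.15) applied to the (unit-scalar) covariant derivative (3.3) of a site field `l`, read in the algebra along `φ`, IS `L⁻¹ ·` the covariant
derivative of the site averaging `Q′(V)l` of (3.19) (`B9Eq319QprimeTorus.QprimeLin` at the transporters of `V`) with respect to the BLOCK-AVERAGED
background `V̄_c = bavg L Ṽ (L·c₋) κ` ((42) of [Balaban1985Averaging]) on the coarse torus: at the coarse bond `c = ⟨y, y + e_κ⟩`,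
`(Q(V)(φ∘D_V l))(c) = L⁻¹·(R(V̄_c)φ((Q′(V)l)(y + e_κ)) − φ((Q′(V)l)(y)))`.  PROOF: lit-balaban's `B9Eq3114Proof.eq3114` (the identity on `ℤ^d`, every
background whose block loops lie in the disc of the logarithm — here E162's `hreg`, `α ≤ 1∕64 < 1`) read through the periodic extension
(`QtorusLin_apply`, `perCfg_toAlg_covDeriv_one`, `toAlg_QprimeLin`); the wrap of `y_κ` is a fine period, invisible to `hol ∘ perCfg` and `perSite`.
[cite: Balaban1985BackgroundPropagators, (3.114) p.418, (3.15) p.393, (3.19) p.393, (3.3) p.391; Balaban1985Averaging, (42) p.23, (124) p.36] -/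
theorem QtorusLin_toAlg_covDeriv (l : TSite d (fineP L P) → W) (y : TSite d P) (κ : Fin d) :
    QtorusLin L P hL V hα1 hV1 hreg (fun b => φ (covDeriv (1 : ℂ) (adTransportW φ V) l b)) (y, κ) =
      ((L : ℂ))⁻¹ • (conjR (bavg L (perCfg (fineP L P) V) (cornerSite L y) κ) (φ (QprimeLin L P (adTransportW φ V) l (shift κ y)))
        - φ (QprimeLin L P (adTransportW φ V) l y)) := by
  have hW : ∀ r : Fin d → Fin L, ‖((Wcx L (perCfg (fineP L P) V) (cornerSite L y) κ (boxVec L r) : 𝔸ˣ) : 𝔸) - 1‖ < 1 :=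
    fun r => lt_of_le_of_lt (hreg y κ r) (lt_of_le_of_lt hα1 (by norm_num))
  rw [QtorusLin_apply, perCfg_toAlg_covDeriv_one, eq3114 L hL _ _ _ _ hW, toAlg_QprimeLin, toAlg_QprimeLin]
  obtain ⟨t, ht⟩ := cornerSite_add_smul_e L P y κ
  congr 3
  refine Finset.sum_congr rfl fun r _ => ?_
  rw [ht, hol_perCfg_add_periodVec, ← ht, add_right_comm, perSite_cornerSite_add_boxVec_add]

end OneStep

/-! ## §3 (3.115) on the tower: `Q_k(U)(D_U l) = D̄ᵏ(Q′_k(U) l)` by iteration of (3.114) -/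

section Tower

variable {𝔸 : Type*} [NormedRing 𝔸] [NormedAlgebra ℂ 𝔸] [CompleteSpace 𝔸] [NormOneClass 𝔸]
  {W : Type*} [NormedAddCommGroup W] [InnerProductSpace ℂ W] (φ : W ≃ₗ[ℂ] 𝔸)
  (L : ℕ) [NeZero L] (m : Fin d → ℕ) [∀ i, NeZero (m i)] (hL : 1 ≤ L)
  (Ulev : (n : ℕ) → Bond d (towerP L m (n + 1)) → 𝔸ˣ) (α : ℕ → ℝ) (hα1 : ∀ n, α n ≤ 1 / 64)
  (hU1 : ∀ (n : ℕ) (x : B7Prop1Explicit.Site d) (κ : Fin d), perCfg (towerP L m (n + 1)) (Ulev n) x κ ∈ U1 𝔸)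
  (hreg : ∀ (n : ℕ) (y : TSite d (towerP L m n)) (κ : Fin d) (r : Fin d → Fin L),
    ‖((Wcx L (perCfg (towerP L m (n + 1)) (Ulev n)) (cornerSite L y) κ (boxVec L r) : 𝔸ˣ) : 𝔸) - 1‖ ≤ α n)
  (Wlev : (n : ℕ) → Bond d (towerP L m n) → 𝔸ˣ) (k : ℕ)
  (hfine : ∀ n, n < k → Wlev (n + 1) = Ulev n)
  (hbar : ∀ n, n < k → ∀ (y : TSite d (towerP L m n)) (κ : Fin d),
    Wlev n (y, κ) = bavg L (perCfg (towerP L m (n + 1)) (Ulev n)) (cornerSite L y) κ)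

include hfine hbar in
/-- **(3.115) FOR A TOWER OF LEVEL BACKGROUNDS** — *«Iterating this identity we obtain finally Q_jDλ = D̄ʲQ′_jλ»* (p. 418): for the composite vector
averaging `B9Eq315QTower.Qtower` of (3.15) over `j ≤ k` levels (level data `Ulev`, E162's per-level letters) and a family `Wlev` of bond backgrounds
with `Wlev (n+1) = Ulev n` (the fine background of each step) and `Wlev n = ` the block average (42) of `Ulev n` (compatibility of consecutive levels,
both DISPLAYED), the depth-`j` composite of `φ ∘ D_{Wlev j} l` is `L^{−j} ·` the covariant derivative with respect to `Wlev 0` of the composite site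
averaging `B9Eq315QTower.QprimeTower` of (3.19) at the transporters of the `Ulev`, read in the algebra — by induction on `j` from `QtorusLin_toAlg_covDeriv`.
[cite: Balaban1985BackgroundPropagators, (3.115) p.418, (3.15) p.393, (3.19) p.393] -/
theorem Qtower_toAlg_covDeriv : ∀ {j : ℕ}, j ≤ k → ∀ (l : TSite d (towerP L m j) → W) (y : TSite d m) (κ : Fin d),
    Qtower L m hL Ulev α hα1 hU1 hreg j (fun b => φ (covDeriv (1 : ℂ) (adTransportW φ (Wlev j)) l b)) (y, κ) =
      (((L : ℂ) ^ j))⁻¹ • (conjR (Wlev 0 (y, κ)) (φ (QprimeTower L m (fun i => adTransportW φ (Ulev i)) j l (shift κ y)))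
        - φ (QprimeTower L m (fun i => adTransportW φ (Ulev i)) j l y))
  | 0, _, l, y, κ => by
      show φ (covDeriv (1 : ℂ) (adTransportW φ (Wlev 0)) l (y, κ)) = _
      rw [pow_zero, inv_one, one_smul, toAlg_covDeriv_one]
      rfl
  | j + 1, hj, l, y, κ => by
      have hjk : j < k := Nat.lt_of_succ_le hj
      -- one step (3.114) at level `j`: `Q(U_j)(φ ∘ D_{W_{j+1}} l) = L⁻¹ • φ ∘ D_{W_j}(Q′(U_j) l)`
      have hstep : QtorusLin L (towerP L m j) hL (Ulev j) (hα1 j) (hU1 j) (hreg j)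
            (fun b => φ (covDeriv (1 : ℂ) (adTransportW φ (Wlev (j + 1))) l b)) =
          ((L : ℂ))⁻¹ • fun c => φ (covDeriv (1 : ℂ) (adTransportW φ (Wlev j))
            (QprimeLin L (towerP L m j) (adTransportW φ (Ulev j)) l) c) := by
        funext c
        obtain ⟨y', κ'⟩ := c
        rw [hfine j hjk]
        simp only [Pi.smul_apply]
        rw [toAlg_covDeriv_one, hbar j hjk]
        exact QtorusLin_toAlg_covDeriv φ L (towerP L m j) hL (Ulev j) (hα1 j) (hU1 j) (hreg j) l y' κ'
      show Qtower L m hL Ulev α hα1 hU1 hreg j (QtorusLin L (towerP L m j) hL (Ulev j) (hα1 j) (hU1 j) (hreg j)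
          (fun b => φ (covDeriv (1 : ℂ) (adTransportW φ (Wlev (j + 1))) l b))) (y, κ) = _
      rw [hstep, map_smul, Pi.smul_apply, Qtower_toAlg_covDeriv (Nat.le_of_succ_le hj) _ y κ, smul_smul, ← mul_inv, ← pow_succ']
      rfl

end Tower

/-! ## §4 (3.115) for the chain's `Q_{n+1}(U)`, `Q′_{n+1}(U)` on the weighted `L²` carriers, and the letter (g2) -/

section Chain

variable {𝔸 : Type*} [NormedRing 𝔸] [NormedAlgebra ℂ 𝔸] [CompleteSpace 𝔸] [NormOneClass 𝔸]
  {W : Type*} [NormedAddCommGroup W] [InnerProductSpace ℂ W] (φ : W ≃ₗ[ℂ] 𝔸) {c₀ c₁ : ℝ} [Fact (0 < c₀)] (η : ℝ)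
  (L : ℕ) [NeZero L] (m : Fin d → ℕ) [∀ i, NeZero (m i)] (n : ℕ) (hL : 1 ≤ L)
  (U : Bond d (towerP L m (n + 1)) → 𝔸ˣ) (αU : ℕ → ℝ) (hα1 : ∀ j, αU j ≤ 1 / 64)
  (hU1 : ∀ (j : ℕ) (x : B7Prop1Explicit.Site d) (κ : Fin d), perCfg (towerP L m (j + 1)) (UlevOf L m (n + 1) U j) x κ ∈ U1 𝔸)
  (hreg : ∀ (j : ℕ) (y : TSite d (towerP L m j)) (κ : Fin d) (r : Fin d → Fin L),
    ‖((Wcx L (perCfg (towerP L m (j + 1)) (UlevOf L m (n + 1) U j)) (cornerSite L y) κ (boxVec L r) : 𝔸ˣ) : 𝔸) - 1‖ ≤ αU j)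

/-- **(3.115) `Q_kDλ = D̄ᵏQ′_kλ` FOR THE CHAIN's COMPOSITE AVERAGINGS ON THE WEIGHTED `L²` CARRIERS** (`k = n+1` levels, ONE background `U` on the finest
torus `T_{L^{n+1}m}`, print's family `Ū^j` = `B9Eq315QTower.UlevOf`): the composite vector averaging `B9Eq326OperatorTower.QkW` of (3.15)∕(3.16) applied to
the covariant derivative (3.3) `covDerivL2K` (scalar `η⁻¹`, transporters of `U`) of an `L²` gauge parameter `l` IS, at the unit-torus bond `⟨y, y + e_κ⟩`,
`η⁻¹L^{−(n+1)}·(R(Ū^{n+1}(y,κ))(Q′_{n+1}(U)l)(y + e_κ) − (Q′_{n+1}(U)l)(y))` — the covariant derivative with respect to the `(n+1)`-fold averaged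
background `Ū^{n+1}` (read at the representatives) of the composite site averaging `B9Eq326OperatorTower.QprimeTowerW` of (3.19)∕(3.24).
MECHANISM: `Qtower_toAlg_covDeriv` at the family `W_j := Ū^{n+1−j}` (`W_{j+1} = UlevOf … j` by definition; `W_j = ` the block average of `W_{j+1}` by
`avgIter_succ` and `perCfg_UlevOf`), the scalar `η⁻¹` factored out. [cite: Balaban1985BackgroundPropagators, (3.115) p.418, (3.15)–(3.16) p.393, (3.19) p.393, (3.24) p.394, (3.3) p.391; Balaban1985Averaging, (42)–(43) pp.23–24] -/
theorem equiv_QkW_covDerivL2K (l : SiteL2K ℂ d (towerP L m (n + 1)) c₀ W) (y : TSite d m) (κ : Fin d) :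
    WL2.equiv ℂ _ W (QkW L m n φ U hL αU hα1 hU1 hreg (c₀ := c₀) (c₁ := c₁) (covDerivL2K ℂ c₀ ((η : ℂ))⁻¹ (adTransportW φ U) l)) (y, κ) =
      (((η : ℂ))⁻¹ * (((L : ℂ) ^ (n + 1)))⁻¹) •
        (adTransportW φ (fun c : Bond d m => avgIter L (perCfg (towerP L m (n + 1)) U) (n + 1) (liftSite c.1) c.2) (y, κ)
            (QprimeTowerW L m n φ U l (shift κ y)) - QprimeTowerW L m n φ U l y) := by
  set Wl : (j : ℕ) → Bond d (towerP L m j) → 𝔸ˣ := fun j b => avgIter L (perCfg (towerP L m (n + 1)) U) (n + 1 - j) (liftSite b.1) b.2 with hWl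
  have hfine : ∀ j, j < n + 1 → Wl (j + 1) = UlevOf L m (n + 1) U j := fun j _ => by
    funext b
    show avgIter L _ (n + 1 - (j + 1)) _ _ = avgIter L _ (n + 1 - 1 - j) _ _
    rw [show n + 1 - (j + 1) = n + 1 - 1 - j by omega]
  have hbar : ∀ j, j < n + 1 → ∀ (y : TSite d (towerP L m j)) (κ : Fin d),
      Wl j (y, κ) = bavg L (perCfg (towerP L m (j + 1)) (UlevOf L m (n + 1) U j)) (cornerSite L y) κ := fun j hj y κ => by
    rw [perCfg_UlevOf L m (by omega : j + 1 ≤ n + 1), cornerSite_eq, corner_eq_smul]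
    show avgIter L _ (n + 1 - j) (liftSite y) κ = _
    rw [show n + 1 - j = n + 1 - 1 - j + 1 by omega, avgIter_succ]
    rfl
  have htop : ∀ b, Wl (n + 1) b = U b := fun b => by
    show avgIter L _ (n + 1 - (n + 1)) _ _ = _
    rw [Nat.sub_self, avgIter_zero, perCfg_apply, perSite_liftSite]
  have e1 : (fun b => φ (covDeriv (1 : ℂ) (adTransportW φ U) (WL2.equiv ℂ _ W l) b)) =
      fun b => φ (covDeriv (1 : ℂ) (adTransportW φ (Wl (n + 1))) (WL2.equiv ℂ _ W l) b) := by
    funext b; rw [toAlg_covDeriv_one, toAlg_covDeriv_one, htop b]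
  have htow := Qtower_toAlg_covDeriv φ L m hL (UlevOf L m (n + 1) U) αU hα1 hU1 hreg Wl (n + 1) hfine hbar le_rfl (WL2.equiv ℂ _ W l) y κ
  show φ.symm (QkOfU L m hL (n + 1) U αU hα1 hU1 hreg (fun b => φ (covDeriv ((η : ℂ))⁻¹ (adTransportW φ U) (WL2.equiv ℂ _ W l) b)) (y, κ)) = _
  rw [toAlg_covDeriv_smul, map_smul, Pi.smul_apply, e1]
  show φ.symm (((η : ℂ))⁻¹ • Qtower L m hL (UlevOf L m (n + 1) U) αU hα1 hU1 hreg (n + 1)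
      (fun b => φ (covDeriv (1 : ℂ) (adTransportW φ (Wl (n + 1))) (WL2.equiv ℂ _ W l) b)) (y, κ)) = _
  rw [htow, smul_smul, map_smul, map_sub, LinearEquiv.symm_apply_apply, conjR_apply, adTransportW_apply]
  rfl

/-- **«In particular they imply that the average QA are invariant with respect to gauge transformations λ satisfying Q′λ = 0, i.e. λ ∈ N(Q′)»**
(p. 418, after (3.115)) FOR THE CHAIN's `k`-TH-STEP LETTERS — the displayed letter (g2) of the NE9 owner's `B9Eq3119DeltaPiTower` (the `Δ_π` port,
gen 87) VERBATIM: if the composite site averaging `Q′_{n+1}(U)λ` vanishes, so does the composite vector averaging of the pure-gauge 1-form `D_Uλ`,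
`Q_{n+1}(U)(D_Uλ) = 0` — whatever per-level regularity witnesses `(αU, hα1, hU1, hreg)` the chain carries (their block loops lie in the disc of the
logarithm, `α_j ≤ 1∕64 < 1`, which is all (3.114) needs). [cite: Balaban1985BackgroundPropagators, p.418, (3.115) p.418, (3.124) p.420] -/
theorem QkW_covDerivL2K_eq_zero_of_QprimeTowerW_eq_zero (l : SiteL2K ℂ d (towerP L m (n + 1)) c₀ W) (hl : QprimeTowerW L m n φ U l = 0) :
    QkW L m n φ U hL αU hα1 hU1 hreg (c₀ := c₀) (c₁ := c₁) (covDerivL2K ℂ c₀ ((η : ℂ))⁻¹ (adTransportW φ U) l) = 0 := by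
  apply (WL2.equiv ℂ (fun _ : Bond d m => c₁) W).injective
  funext c
  obtain ⟨y, κ⟩ := c
  rw [equiv_QkW_covDerivL2K, hl, Pi.zero_apply, Pi.zero_apply, map_zero, sub_zero, smul_zero]
  rfl

/-- **`Q_{n+1}(U)` IS INVARIANT UNDER THE LINEAR GAUGE TRANSFORMATIONS OF `N(Q′_{n+1}(U))`**: `Q_{n+1}(U)(A − D_Uλ) = Q_{n+1}(U)A` whenever
`Q′_{n+1}(U)λ = 0` — print's sentence after (3.115) at the chain's letters (lit-balaban's `B9Eq3114Proof.linCovIter_gauge_of_null` is its `ℤᵈ` form).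
[cite: Balaban1985BackgroundPropagators, p.418] -/
theorem QkW_sub_covDerivL2K_of_QprimeTowerW_eq_zero (A : BondL2K ℂ d (towerP L m (n + 1)) c₀ W)
    (l : SiteL2K ℂ d (towerP L m (n + 1)) c₀ W) (hl : QprimeTowerW L m n φ U l = 0) :
    QkW L m n φ U hL αU hα1 hU1 hreg (c₀ := c₀) (c₁ := c₁) (A - covDerivL2K ℂ c₀ ((η : ℂ))⁻¹ (adTransportW φ U) l) =
      QkW L m n φ U hL αU hα1 hU1 hreg (c₀ := c₀) (c₁ := c₁) A := by
  rw [map_sub, QkW_covDerivL2K_eq_zero_of_QprimeTowerW_eq_zero φ η L m n hL U αU hα1 hU1 hreg l hl, sub_zero]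

end Chain

end Literature.MathematicalPhysics.QuantumFieldTheory.Balaban1983to89.B9Eq3115QkGaugeModeTower

end
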